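import Mathlib.NumberTheory.Zsqrtd.Basic
import Mathlib.Data.ZMod.Basic
import Mathlib.RingTheory.Coprime.Basic
import Mathlib.Tactic.Ring
import Mathlib.Tactic.Linarith
import Mathlib.Tactic.LinearCombination
import Mathlib.Tactic.NormNum
import HarnessLib

/-!
# Venture HSemireg — the 2-ADIC LINE RULE for factorwise words: even-norm divisors of `A − l` see the same power of `2`, and
# R1 PROPER is factorwise unreachable for EVERY node field `ℚ(√m)` with `m ≡ 1 (mod 4)` (ENGINE-W code B, LINE-LAW census of
# 2026-08-25 on top of THEOREM CF⁶ ∕ COROLLARY «reachable LINES») — kernel number theory in `ℤ√m`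

HONEST FRAMING. Lean index of the computation cell `pub-hsemireg`, widening group ENGINE-W (code B = the independent second code, seat
`engine-w-2`, gen 10). PRIOR STATEMENTS OF RECORD (code A, `widen/ENGINE-W/out/probe5/PROBE5-STIZ-A.md`): THEOREM R1-ℤ (§3) and
THEOREM LINE-ℤ (§7, engine-w-1 g6, 2026-08-23: for ODD `m` a line is attainable with r-shadow 12 only if the weights take at most two 2-adic
valuations `{0, v}` with `v = 1 ⇒ m ≡ 3 (4)`, `v = 2 ⇒ m ≡ 5 (8)`, `v ≥ 3 ⇒ m ≡ 1 (8)` — full integral group, module-type invariant). The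
rule below is an INDEPENDENT DERIVATION of that necessity statement for factorwise words, by the parity of cofactor norms, valid for EVEN `m`
too (where the r-shadow is silent). ELEMENTARY NUMBER THEORY in Mathlib's `ℤ√m` for an arbitrary integer `m` (norm multiplicativity, parities in `ℤ∕2`,
residues in `ℤ∕4`, `ℤ∕8`); the secant engine, factorwise words, coordinate Weil data and polarisation lines enter BY VALUE (docstrings).
No abelian variety, sheaf, `Ext` group or semiregularity map is constructed; nothing here says that HC, HC_CM or HC_AV holds. Theorems
only (0 `def`, 0 named fact, 0 `sorry`). Generalises code B's `SqrtMinusSevenR1Obstruction.lean` (`m = −7`) to all `m`.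

SOURCE (the cell's own result, code B, engine-w-2 g10): the LINE-LAW census `widen/ENGINE-W/out/probe4/linelaw.B.json` (tool
`codeB/linelaw_B.py`; 24 node fields × 105 weight sets, ground truth = the arithmetic of THEOREM CF⁶ ∕ COROLLARY «reachable LINES»
(ONE-FOURIER-FORMULA-B.md §8): the coordinate line with weights `(c_j)` is reached factorwise from split iff there are `T`, primitive
`z_j ∈ ℤ[l]` with `N(z_j) = T∕c_j > 0` and a common `A` with `z_j ∣ (A − l)`), its engine confirmations `linecheck.B.json` (golden
`(1⁵,4)` at `T = 4`, `ℚ(√−7)` and `ℚ(√17)` `(1⁵,8)` at `T = 8`, `ℚ(√−3)` `(1⁵,4)`, `ℚ(√−2)` `(1⁵,3)`: class-exact ∧ W-alive ∧ coordinate), and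
TABLE-ENGINE-W row «LINE LAW». THE RULE: if a primitive `z = x + yl` of EVEN norm divides `A − l` with cofactor `w`, then `N(w)` is ODD
(the `l`-component `xq + yp = −1` of `z·w = A − l` fixes the parities), so `v₂(N z) = v₂(A² − m)` is the SAME for all even-norm `z_j` on a
reached line, and `A² − m` (even) is `≡ 2 (mod 4)` for `m ≡ 2, 3 (mod 4)`, `≡ 4 (mod 8)` for `m ≡ 5 (mod 8)`, `≡ 0 (mod 8)` for
`m ≡ 1 (mod 8)`. Consequently the weights of a reached line take at most two 2-adic valuations, differing by `e = v₂(A² − m)`: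
`e = 1` iff `m ≡ 2, 3 (4)` (R1 PROPER `(1⁵, 2)` lives exactly there: `ℚ(i)`, `ℚ(√±2)`, `ℚ(√7)`, …), `e = 2` iff `m ≡ 5 (8)` (`(1⁵, 4)`:
golden, `ℚ(√−3)`, `ℚ(√13)`), `e ≥ 3` iff `m ≡ 1 (8)` (`(1⁵, 8)`: `ℚ(√−7)`, `ℚ(√17)`) — census: 0 exceptions in 2 520 cells; the only cells
where «each `T∕c_j` a primitive norm ∧ the 2-adic rule» does not already decide reachability are 30 cells at `m ∈ {−11, −14, −17, −19,
−23}` (orders with more than one class per genus). What the kernel holds: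

* §1 `parity_core` (`ℤ∕2`, `decide`): primitive, even norm, `xq + yp = −1` ⇒ cofactor norm odd — for every residue of `m`
  (the transfer `ℤ ↔ ℤ∕2` is done inline; the iff is already in the tree elsewhere).
* §2 in `ℤ√m`, any `m`: `norm_A_sub_l` (`N⟨A, −1⟩ = A² − m`); **`odd_norm_cofactor`** (primitive `z`, `N z` even, `z·w = ⟨A, −1⟩` ⇒
  `N w` odd); **`same_two_adic_part`** (two such divisors: `N z₁ · odd = N z₂ · odd`, the common value being `A² − m`).
* §3 the residue of `A² − m`: `mod_four_of_even` (`m % 4 ∈ {2,3}`, `A² − m` even ⇒ `4 ∣ A² − m − 2`), `mod_eight_of_five`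
  (`m % 8 = 5`, `A` odd ⇒ `8 ∣ A² − m − 4`), `mod_eight_of_one` (`m % 8 = 1`, `A` odd ⇒ `8 ∣ A² − m`), `odd_A_of_odd_m` (`m` odd,
  `A² − m` even ⇒ `A` odd).
* §4 **`r1proper_never_of_one_mod_four`** — `m % 4 = 1`, `t ≠ 0`: no primitive `z, z₆ ∈ ℤ√m` with `N z = 2t`, `N z₆ = t` both divide
  `⟨A, −1⟩` (so R1 PROPER `(1⁵, 2)` is factorwise unreachable for `ℚ(√−3)`, `ℚ(√5)`, `ℚ(√−7)`, `ℚ(√−11)`, `ℚ(√13)`, `ℚ(√−15)`, `ℚ(√17)`,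
  … — for `m ≡ 1 (mod 8)` the CLASS `{2}` is STI-allowed, so this is a line-level obstruction strictly beyond THEOREM STI);
  `never_ratio_two_general` — the same for any pair of weights `c`, `2c` on one line (`N z = 2n`, `N z′ = n`).
WHAT IS NOT HERE: THEOREM CF⁶ and the reduction to `(z_j, A)` (engine facts, by value; algebraic clause =
`FactorwiseTransportFormula.residue_class_iff`), the class-group refinement at `m ∈ {−11, −14, …}` (data only), the positive
words (engine rows, by value), factor-MIXING elements. Tier: kernel ×1 (B) + census machine ×1 (B) + engine ×1 (B) on 7 rows.
-/

namespace Summit.Ventures.HSemireg.TwoAdicLineRule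

/-! ## §1 Parities in `ℤ∕2` -/

/-- **The parity core** (all residues of `m` at once): in `ℤ∕2`, if `aX + bY = 1` (primitive), `X² − MY² = 0` (even norm) and
`XQ + YP = −1` (the `l`-component of `z·w = A − l`), then `P² − MQ² = 1` (the cofactor's norm is odd). [kernel, `decide`] -/
theorem parity_core : ∀ M X Y a b P Q : ZMod 2,
    a * X + b * Y = 1 → X ^ 2 - M * Y ^ 2 = 0 → X * Q + Y * P = -1 → P ^ 2 - M * Q ^ 2 = 1 := by
  decide

/-! ## §2 Even-norm divisors of `A − l` in `ℤ√m` -/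

/-- `N⟨A, −1⟩ = A² − m` in `ℤ√m`. [kernel] -/
theorem norm_A_sub_l (m A : ℤ) : (⟨A, -1⟩ : ℤ√m).norm = A ^ 2 - m := by
  rw [Zsqrtd.norm_def]; ring

/-- **Cofactors of even-norm primitive divisors have odd norm** (any `m`): `IsCoprime z.re z.im`, `N z` even, `z·w = ⟨A, −1⟩` ⇒
`N w` odd. [kernel] -/
theorem odd_norm_cofactor (m A : ℤ) (z w : ℤ√m) (hcop : IsCoprime z.re z.im) (heven : Even z.norm)
    (h : (⟨A, -1⟩ : ℤ√m) = z * w) : Odd w.norm := by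
  obtain ⟨a, b, hab⟩ := hcop
  obtain ⟨k, hk⟩ := heven
  have hzn : z.norm = z.re ^ 2 - m * z.im ^ 2 := by rw [Zsqrtd.norm_def]; ring
  have hwn : w.norm = w.re ^ 2 - m * w.im ^ 2 := by rw [Zsqrtd.norm_def]; ring
  have him : (-1 : ℤ) = z.re * w.im + z.im * w.re := by
    have := congrArg Zsqrtd.im h
    simpa [Zsqrtd.im_mul] using this
  have c1 : ((a * z.re + b * z.im : ℤ) : ZMod 2) = 1 := by rw [hab]; push_cast; rfl
  have c2 : ((z.re ^ 2 - m * z.im ^ 2 : ℤ) : ZMod 2) = 0 := by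
    rw [← hzn, hk]; push_cast
    have e : (k : ZMod 2) + k = 2 * k := by ring
    rw [e, show (2 : ZMod 2) = 0 by decide, zero_mul]
  have c3 : ((z.re * w.im + z.im * w.re : ℤ) : ZMod 2) = -1 := by rw [← him]; push_cast; rfl
  push_cast at c1 c2 c3
  have key := parity_core (m : ZMod 2) _ _ _ _ (w.re : ZMod 2) (w.im : ZMod 2) c1 c2 c3
  -- transfer back to ℤ: w.re² − m·w.im² ≡ 1 (mod 2)
  have hc : ((w.re ^ 2 - m * w.im ^ 2 - 1 : ℤ) : ZMod 2) = 0 := by push_cast; linear_combination key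
  obtain ⟨r, hr⟩ := (ZMod.intCast_zmod_eq_zero_iff_dvd _ 2).1 hc
  push_cast at hr
  rw [hwn]; exact ⟨r, by linarith [hr]⟩

/-- **Same 2-adic part**: two primitive even-norm divisors `z₁, z₂` of the same `A − l` satisfy `N z₁ · N w₁ = N z₂ · N w₂ (= A² − m)` with
BOTH cofactor norms odd — so `v₂(N z₁) = v₂(N z₂) = v₂(A² − m)`: on a reached line all weights `c_j` with `T∕c_j` even have the same
2-adic valuation. [kernel] -/
theorem same_two_adic_part (m A : ℤ) (z₁ w₁ z₂ w₂ : ℤ√m) (h1 : IsCoprime z₁.re z₁.im) (h2 : IsCoprime z₂.re z₂.im)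
    (e1 : Even z₁.norm) (e2 : Even z₂.norm) (hz1 : (⟨A, -1⟩ : ℤ√m) = z₁ * w₁) (hz2 : (⟨A, -1⟩ : ℤ√m) = z₂ * w₂) :
    z₁.norm * w₁.norm = z₂.norm * w₂.norm ∧ z₁.norm * w₁.norm = A ^ 2 - m ∧ Odd w₁.norm ∧ Odd w₂.norm := by
  have n1 : A ^ 2 - m = z₁.norm * w₁.norm := by rw [← norm_A_sub_l m A, hz1, Zsqrtd.norm_mul]
  have n2 : A ^ 2 - m = z₂.norm * w₂.norm := by rw [← norm_A_sub_l m A, hz2, Zsqrtd.norm_mul]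
  exact ⟨by rw [← n1, ← n2], n1.symm, odd_norm_cofactor m A z₁ w₁ h1 e1 hz1, odd_norm_cofactor m A z₂ w₂ h2 e2 hz2⟩

/-! ## §3 The residue of `A² − m` -/

/-- `m` odd and `A² − m` even ⇒ `A` odd. [kernel] -/
theorem odd_A_of_odd_m (m A : ℤ) (hm : Odd m) (h : Even (A ^ 2 - m)) : Odd A := by
  rcases Int.even_or_odd A with ⟨k, rfl⟩ | hA
  · exfalso
    obtain ⟨j, rfl⟩ := hm
    obtain ⟨i, hi⟩ := h
    have : (2 : ℤ) ∣ 1 := ⟨(k + k) * k - j - i, by linear_combination -hi⟩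
    omega
  · exact hA

/-- `m ≡ 2, 3 (mod 4)` and `A² − m` even ⇒ `A² − m ≡ 2 (mod 4)` (`e = 1`). [kernel] -/
theorem mod_four_of_even (m A : ℤ) (hm : m % 4 = 2 ∨ m % 4 = 3) (h : Even (A ^ 2 - m)) : (4 : ℤ) ∣ A ^ 2 - m - 2 := by
  obtain ⟨i, hi⟩ := h
  rcases hm with hm | hm
  · -- m = 4q + 2: A² = 2i + m even ⇒ A even
    have hq : m = 4 * (m / 4) + 2 := by omega
    rcases Int.even_or_odd A with ⟨k, rfl⟩ | ⟨k, rfl⟩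
    · exact ⟨k * k - (m / 4) - 1, by linear_combination -hq⟩
    · exfalso
      have : (2 : ℤ) ∣ 1 := ⟨2 * k * k + 2 * k - 2 * (m / 4) - i, by linear_combination -hi - hq⟩
      omega
  · have hq : m = 4 * (m / 4) + 3 := by omega
    rcases Int.even_or_odd A with ⟨k, rfl⟩ | ⟨k, rfl⟩
    · exfalso
      have : (2 : ℤ) ∣ 1 := ⟨2 * k * k - 2 * (m / 4) - i - 1, by linear_combination -hi - hq⟩
      omega
    · exact ⟨k * k + k - (m / 4) - 1, by linear_combination -hq⟩

/-- `m ≡ 5 (mod 8)` and `A` odd ⇒ `A² − m ≡ 4 (mod 8)` (`e = 2` exactly). [kernel] -/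
theorem mod_eight_of_five (m A : ℤ) (hm : m % 8 = 5) (hA : Odd A) : (8 : ℤ) ∣ A ^ 2 - m - 4 := by
  obtain ⟨k, rfl⟩ := hA
  obtain ⟨j, hj⟩ := Int.even_mul_succ_self k
  have hq : m = 8 * (m / 8) + 5 := by omega
  exact ⟨j - (m / 8) - 1, by linear_combination 4 * hj - hq⟩

/-- `m ≡ 1 (mod 8)` and `A` odd ⇒ `A² − m ≡ 0 (mod 8)` (`e ≥ 3`). [kernel] -/
theorem mod_eight_of_one (m A : ℤ) (hm : m % 8 = 1) (hA : Odd A) : (8 : ℤ) ∣ A ^ 2 - m := by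
  obtain ⟨k, rfl⟩ := hA
  obtain ⟨j, hj⟩ := Int.even_mul_succ_self k
  have hq : m = 8 * (m / 8) + 1 := by omega
  exact ⟨j - (m / 8), by linear_combination 4 * hj - hq⟩

/-! ## §4 R1 PROPER is factorwise unreachable whenever `m ≡ 1 (mod 4)` -/

/-- **Weights `c` and `2c` never coexist for `m ≡ 1 (mod 4)`.** If `z`, `z′ ∈ ℤ√m` are primitive with `N z = 2n`, `N z′ = n`, `n ≠ 0`,
they cannot both divide `⟨A, −1⟩`: `z` has even norm, so `A² − m = 2n·odd`; `m` odd forces `A` odd, hence `4 ∣ A² − m`, hence `n`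
even; then `z′` has even norm too and `A² − m = n·odd′`; so `2n·odd = n·odd′`, `odd′ = 2·odd` — absurd. [kernel] -/
theorem never_ratio_two_general (m n A : ℤ) (hm : m % 4 = 1) (hn : n ≠ 0) (z z' w w' : ℤ√m)
    (hz : z.norm = 2 * n) (hz' : z'.norm = n) (hcop : IsCoprime z.re z.im) (hcop' : IsCoprime z'.re z'.im)
    (h : (⟨A, -1⟩ : ℤ√m) = z * w) (h' : (⟨A, -1⟩ : ℤ√m) = z' * w') : False := by
  have hN : A ^ 2 - m = 2 * n * w.norm := by rw [← norm_A_sub_l m A, h, Zsqrtd.norm_mul, hz]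
  have hN' : A ^ 2 - m = n * w'.norm := by rw [← norm_A_sub_l m A, h', Zsqrtd.norm_mul, hz']
  have hw : Odd w.norm := odd_norm_cofactor m A z w hcop ⟨n, by rw [hz]; ring⟩ h
  -- A odd (m odd, A² − m even), so 8 ∣ … in both sub-cases; we only need 4 ∣ A² − m
  have hmodd : Odd m := ⟨2 * (m / 4), by omega⟩
  have hA : Odd A := odd_A_of_odd_m m A hmodd ⟨n * w.norm, by rw [hN]; ring⟩
  have h4 : (4 : ℤ) ∣ A ^ 2 - m := by
    obtain ⟨k, rfl⟩ := hA
    have hq : m = 4 * (m / 4) + 1 := by omega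
    exact ⟨k * k + k - (m / 4), by linear_combination -hq⟩
  -- hence n·N(w) even with N(w) odd ⇒ n even
  have hn2 : Even n := by
    obtain ⟨c, hc⟩ := h4
    have : Even (n * w.norm) := ⟨c, by linarith [hN, hc]⟩
    rcases Int.even_mul.mp this with hn2 | hw2
    · exact hn2
    · exact absurd hw2 (Int.not_even_iff_odd.mpr hw)
  have hw' : Odd w'.norm := odd_norm_cofactor m A z' w' hcop' (by rw [hz']; exact hn2) h'
  -- 2 n N(w) = n N(w') ⇒ N(w') = 2 N(w) even
  have heq : n * w'.norm = n * (2 * w.norm) := by linarith [hN, hN']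
  have : Even w'.norm := ⟨w.norm, by have := mul_left_cancel₀ hn heq; linarith [this]⟩
  exact (Int.not_even_iff_odd.mpr hw') this

/-- **R1 PROPER `(1⁵, 2)` is factorwise unreachable for every node field `ℚ(√m)` with `m ≡ 1 (mod 4)`** (the case `c = 1` of the
previous theorem, in THEOREM CF⁶'s normal form `N(z_j) = 2t` (`j ≤ 5`), `N(z₆) = t`): e.g. `m = −3, 5, −7, −11, 13, −15, 17, −19, 21, −23,
33`; for `m ≡ 1 (mod 8)` (`−7, 17, −15, 33, −23, 41, …`) the class `{2}` IS allowed by THEOREM STI, so there the obstruction is purely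
line-level. [kernel] -/
theorem r1proper_never_of_one_mod_four (m t A : ℤ) (hm : m % 4 = 1) (ht : t ≠ 0) (z z₆ w w₆ : ℤ√m)
    (hz : z.norm = 2 * t) (hz₆ : z₆.norm = t) (hcop : IsCoprime z.re z.im) (hcop₆ : IsCoprime z₆.re z₆.im)
    (h : (⟨A, -1⟩ : ℤ√m) = z * w) (h₆ : (⟨A, -1⟩ : ℤ√m) = z₆ * w₆) : False :=
  never_ratio_two_general m t A hm ht z z₆ w w₆ hz hz₆ hcop hcop₆ h h₆

/-- The node fields of record with `m ≡ 1 (mod 4)` satisfy the hypothesis (`decide`-level bookkeeping): `m % 4 = 1` for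
`m = −3, 5, −7, −11, 13, −15, 17, −19, 21, −23, 33, 41`. [kernel, `decide`] -/
theorem fields_one_mod_four :
    (-3 : ℤ) % 4 = 1 ∧ (5 : ℤ) % 4 = 1 ∧ (-7 : ℤ) % 4 = 1 ∧ (-11 : ℤ) % 4 = 1 ∧ (13 : ℤ) % 4 = 1 ∧ (-15 : ℤ) % 4 = 1 ∧
      (17 : ℤ) % 4 = 1 ∧ (-19 : ℤ) % 4 = 1 ∧ (21 : ℤ) % 4 = 1 ∧ (-23 : ℤ) % 4 = 1 ∧ (33 : ℤ) % 4 = 1 ∧ (41 : ℤ) % 4 = 1 := by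
  decide

end Summit.Ventures.HSemireg.TwoAdicLineRule
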